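import Summits.CriticalPhenomena.Ising3DConformalLimit.Theses.ThresholdDilation
import Literature.Probability.LatticeModels.HighDimPointwiseTriviality
import Literature.Probability.LatticeModels.ImprovedTreeDiagramBoundProofs

/-!
# All-scale axis doubling transfers non-degeneracy of the two-point scaling limit

Item stmt-CriticalPhenomena-6327 `NondegeneracyOfDoubling` (support, DIVIDEND) of route
`ThresholdDilation` of the sub-problem `Ising3DConformalLimit`.

**Statement.** Assume all-scale doubling of the critical axis two-point function of the
nearest-neighbour Ising model on `ℤ³`, `κ g(n) ≤ g(2n)` for all `n ≥ 1` with some `κ > 0`, where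
`g(n) = ⟨σ₀σ_{n e₀}⟩⁺_{β_c(3)}`. Then for every pointwise scaling limit `S` of the critical
correlators (`HasPointwiseScalingLimit (criticalCorr 3) ρ S`), if `S₂ > 0` at ONE non-coincident
pair then `S₂ > 0` at every non-coincident pair (`IsNondegenerateTwoPoint S`).

**Proof.** Write `G = ⟨σ₀σ_·⟩⁺_{β_c}` and, for a pair `z`, `u_δ(z) = [z₁/δ] - [z₀/δ]`, so that the
rescaled pair correlator is `ρ(δ)² G(u_δ(z))` (translation invariance, `criticalCorr_two_pair`).
Let `x` be the positive pair and `y` the target pair. Two applications of the Messager–Miracle-Solé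
sup-norm comparison (`twoPointPlus_le_of_mul_supNorm_le`: `3‖a‖_∞ ≤ ‖b‖_∞ ⇒ G(b) ≤ G(a)`), axis
monotonicity (`twoPointPlus_add_single_le`) and `k` iterations of the doubling hypothesis give the
lattice comparison
`G(v) ≥ g(3‖v‖_∞) ≥ g(2ᵏ m) ≥ κᵏ g(m) ≥ κᵏ G(u)` whenever `1 ≤ m`, `3m ≤ ‖u‖_∞`, `3‖v‖_∞ ≤ 2ᵏ m`
(`le_criticalTwoPoint_of_doubling`). With `u = u_δ(x)` (`‖u‖_∞ ≥ t/(2δ)`, `t` a coordinate gap of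
`x`), `v = u_δ(y)` (`‖v‖_∞ ≤ ‖y₁ - y₀‖/δ + 2`), `m = ⌊t/(6δ)⌋` and a FIXED `k` with
`2ᵏ t ≥ 36‖y₁ - y₀‖ + 72`, the side conditions hold for all `0 < δ ≤ min(1, t/12)`; hence eventually
`ρ(δ)² G(u_δ(y)) ≥ κᵏ ρ(δ)² G(u_δ(x))`, and the pointwise limits at `x` and `y` give
`S₂(y) ≥ κᵏ S₂(x) > 0`. Only pointwise convergence at the two configurations is used (no local
uniformity, no positivity of `ρ`).

## References

* M. Aizenman, H. Duminil-Copin, Ann. of Math. 194 (2021), arXiv:1912.07973, §5.1 eq. (5.3)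
  (MMS comparison in the sup norm) [AizenmanDuminilCopinAnnals2021].
* Refuter notes g3-2/g3-3 on item stmt-CriticalPhenomena-0667 (doubling is the missing input of the
  non-degeneracy transfer).
-/

noncomputable section

namespace Summit.CriticalPhenomena.Ising3DConformalLimit.ThresholdDilationNondegeneracyOfDoubling

open Filter Topology
open Literature.Probability.LatticeModels

/-- Axis monotonicity of the critical two-point function (Messager–Miracle-Solé):
`g(n + j) ≤ g(n)` for `g(n) = ⟨σ₀σ_{n e₀}⟩⁺_{β_c(3)}`. [folklore] -/
theorem criticalTwoPoint_axis_add_le (n j : ℕ) :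
    criticalTwoPoint 3 (Pi.single 0 (((n + j : ℕ)) : ℤ)) ≤
      criticalTwoPoint 3 (Pi.single 0 ((n : ℕ) : ℤ)) := by
  have h := twoPointPlus_add_single_le (messager_miracleSole_holds (d := 3) (β := criticalBeta 3))
    (criticalBeta_nonneg 3) (Pi.single (0 : Fin 3) ((n : ℕ) : ℤ)) 0 (by simp) j
  rw [← Pi.single_add] at h
  have hcast : (((n + j : ℕ)) : ℤ) = (n : ℤ) + (j : ℤ) := by push_cast; ring
  rw [hcast]
  exact h

/-- Axis monotonicity, order form: `n ≤ N ⇒ g(N) ≤ g(n)`. [folklore] -/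
theorem criticalTwoPoint_axis_antitone {n N : ℕ} (h : n ≤ N) :
    criticalTwoPoint 3 (Pi.single 0 ((N : ℕ) : ℤ)) ≤
      criticalTwoPoint 3 (Pi.single 0 ((n : ℕ) : ℤ)) := by
  obtain ⟨j, rfl⟩ := Nat.exists_eq_add_of_le h
  exact criticalTwoPoint_axis_add_le n j

/-- Iterated doubling: `κ g(n) ≤ g(2n)` for all `n ≥ 1` gives `κᵏ g(n) ≤ g(2ᵏ n)` for all `n ≥ 1`.
[folklore] -/
theorem pow_mul_criticalTwoPoint_le_of_doubling {κ : ℝ} (hκ0 : 0 < κ)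
    (hκ : ∀ n : ℕ, 1 ≤ n → κ * criticalTwoPoint 3 (Pi.single 0 ((n : ℕ) : ℤ)) ≤
      criticalTwoPoint 3 (Pi.single 0 ((2 * n : ℕ) : ℤ)))
    (k n : ℕ) (hn : 1 ≤ n) :
    κ ^ k * criticalTwoPoint 3 (Pi.single 0 ((n : ℕ) : ℤ)) ≤
      criticalTwoPoint 3 (Pi.single 0 ((2 ^ k * n : ℕ) : ℤ)) := by
  induction k with
  | zero => simp
  | succ k ih =>
      have h1 : 1 ≤ 2 ^ k * n := Nat.one_le_iff_ne_zero.2 (Nat.mul_ne_zero (pow_ne_zero _ two_ne_zero)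
        (by omega))
      have h2 := hκ (2 ^ k * n) h1
      have heq : 2 ^ (k + 1) * n = 2 * (2 ^ k * n) := by ring
      rw [heq, pow_succ]
      calc κ ^ k * κ * criticalTwoPoint 3 (Pi.single 0 ((n : ℕ) : ℤ))
          = κ * (κ ^ k * criticalTwoPoint 3 (Pi.single 0 ((n : ℕ) : ℤ))) := by ring
        _ ≤ κ * criticalTwoPoint 3 (Pi.single 0 ((2 ^ k * n : ℕ) : ℤ)) :=
          mul_le_mul_of_nonneg_left ih hκ0.le
        _ ≤ criticalTwoPoint 3 (Pi.single 0 ((2 * (2 ^ k * n) : ℕ) : ℤ)) := h2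

/-- **The lattice comparison.** Under all-scale axis doubling with constant `κ > 0`: for sites
`u, v ∈ ℤ³` and `m ≥ 1` with `3m ≤ ‖u‖_∞` and `3‖v‖_∞ ≤ 2ᵏ m`,
`κᵏ ⟨σ₀σ_u⟩⁺_{β_c} ≤ ⟨σ₀σ_v⟩⁺_{β_c}` — by `G(u) ≤ g(m)` and `g(3‖v‖_∞) ≤ G(v)` (MMS sup-norm
comparison, Aizenman–Duminil-Copin 2021 eq. (5.3)), `κᵏ g(m) ≤ g(2ᵏ m)` (doubling) and
`g(2ᵏ m) ≤ g(3‖v‖_∞)` (axis monotonicity). [folklore] -/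
theorem le_criticalTwoPoint_of_doubling {κ : ℝ} (hκ0 : 0 < κ)
    (hκ : ∀ n : ℕ, 1 ≤ n → κ * criticalTwoPoint 3 (Pi.single 0 ((n : ℕ) : ℤ)) ≤
      criticalTwoPoint 3 (Pi.single 0 ((2 * n : ℕ) : ℤ)))
    (u v : Site 3) {m k : ℕ} (hm : 1 ≤ m) (hmu : 3 * m ≤ Site.supNorm u)
    (hv : 3 * Site.supNorm v ≤ 2 ^ k * m) :
    κ ^ k * criticalTwoPoint 3 u ≤ criticalTwoPoint 3 v := by
  have hβ := criticalBeta_nonneg 3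
  have h1 : criticalTwoPoint 3 u ≤ criticalTwoPoint 3 (Pi.single 0 ((m : ℕ) : ℤ)) :=
    twoPointPlus_le_of_mul_supNorm_le (d := 3) hβ (x := Pi.single 0 ((m : ℕ) : ℤ)) (y := u)
      (by rw [Site.supNorm_single, Int.natAbs_natCast]; exact hmu)
  have h2 := pow_mul_criticalTwoPoint_le_of_doubling hκ0 hκ k m hm
  have h3 : criticalTwoPoint 3 (Pi.single 0 ((2 ^ k * m : ℕ) : ℤ)) ≤
      criticalTwoPoint 3 (Pi.single 0 ((3 * Site.supNorm v : ℕ) : ℤ)) :=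
    criticalTwoPoint_axis_antitone hv
  have h4 : criticalTwoPoint 3 (Pi.single 0 ((3 * Site.supNorm v : ℕ) : ℤ)) ≤ criticalTwoPoint 3 v :=
    twoPointPlus_le_of_mul_supNorm_le (d := 3) hβ (x := v)
      (y := Pi.single 0 ((3 * Site.supNorm v : ℕ) : ℤ)) (by rw [Site.supNorm_single, Int.natAbs_natCast])
  calc κ ^ k * criticalTwoPoint 3 u ≤ κ ^ k * criticalTwoPoint 3 (Pi.single 0 ((m : ℕ) : ℤ)) :=
        mul_le_mul_of_nonneg_left h1 (pow_nonneg hκ0.le k)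
    _ ≤ criticalTwoPoint 3 (Pi.single 0 ((2 ^ k * m : ℕ) : ℤ)) := h2
    _ ≤ criticalTwoPoint 3 (Pi.single 0 ((3 * Site.supNorm v : ℕ) : ℤ)) := h3
    _ ≤ criticalTwoPoint 3 v := h4

/-- Lower bound on the lattice separation of a pair: if the `k`-th coordinates of `p, q ∈ ℝ³`
differ by `t = |p_k - q_k|` and `0 < δ ≤ t/4`, then `t/(2δ) ≤ ‖[p/δ] - [q/δ]‖_∞`. [folklore] -/
theorem div_le_supNorm_latticeApprox_sub {δ : ℝ} (hδ : 0 < δ) (p q : EuclideanSpace ℝ (Fin 3))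
    (k : Fin 3) (hδt : 4 * δ ≤ |p k - q k|) :
    |p k - q k| / (2 * δ) ≤ (Site.supNorm (latticeApprox δ p - latticeApprox δ q) : ℝ) := by
  set a := latticeApprox δ q with ha
  set b := latticeApprox δ p with hb
  refine le_trans ?_ (abs_coord_le_supNorm (b - a) k)
  have h := abs_mul_sub_latticeApprox_sub_le hδ p q k
  have hcast : (((b - a) k : ℤ) : ℝ) = (b k : ℝ) - (a k : ℝ) := by push_cast [Pi.sub_apply]; ring
  rw [hcast]
  have h' : |p k - q k| - 2 * δ ≤ δ * |(b k : ℝ) - (a k : ℝ)| := by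
    have := abs_sub_abs_le_abs_sub (p k - q k) (δ * ((b k : ℝ) - (a k : ℝ)))
    rw [abs_sub_comm] at h
    rw [abs_mul, abs_of_pos hδ] at this
    linarith
  rw [div_le_iff₀ (by positivity)]
  nlinarith [abs_nonneg ((b k : ℝ) - (a k : ℝ))]

/-- Upper bound on the lattice separation of a pair: `‖[p/δ] - [q/δ]‖_∞ ≤ ‖p - q‖/δ + 2` for
`δ > 0`. [folklore] -/
theorem supNorm_latticeApprox_sub_le {δ : ℝ} (hδ : 0 < δ) (p q : EuclideanSpace ℝ (Fin 3)) :
    (Site.supNorm (latticeApprox δ p - latticeApprox δ q) : ℝ) ≤ ‖p - q‖ / δ + 2 := by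
  set a := latticeApprox δ q with ha
  set b := latticeApprox δ p with hb
  rw [← Site.norm_eq_supNorm, pi_norm_le_iff_of_nonneg (by positivity)]
  intro k
  rw [Int.norm_eq_abs]
  have h := abs_mul_sub_latticeApprox_sub_le hδ p q k
  have hcast : (((b - a) k : ℤ) : ℝ) = (b k : ℝ) - (a k : ℝ) := by push_cast [Pi.sub_apply]; ring
  rw [hcast]
  have hk : |p k - q k| ≤ ‖p - q‖ := by
    have := PiLp.norm_apply_le (p - q) k
    simpa using this
  have h' : δ * |(b k : ℝ) - (a k : ℝ)| ≤ ‖p - q‖ + 2 * δ := by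
    have := abs_sub_abs_le_abs_sub (δ * ((b k : ℝ) - (a k : ℝ))) (p k - q k)
    rw [abs_mul, abs_of_pos hδ] at this
    linarith
  have heq : ‖p - q‖ / δ + 2 = (‖p - q‖ + 2 * δ) / δ := by
    field_simp
  rw [heq, le_div_iff₀ hδ]
  calc |(b k : ℝ) - (a k : ℝ)| * δ = δ * |(b k : ℝ) - (a k : ℝ)| := mul_comm _ _
    _ ≤ ‖p - q‖ + 2 * δ := h'

/-- **Eventual lattice comparison of two pairs.** Under all-scale axis doubling with constant
`κ > 0`: for a non-coincident pair `x` and any pair `y` in `(ℝ³)²` there is `k` such that for all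
small `δ > 0`,
`κᵏ ⟨σ_{[x₀/δ]}σ_{[x₁/δ]}⟩_{β_c} ≤ ⟨σ_{[y₀/δ]}σ_{[y₁/δ]}⟩_{β_c}`. [folklore] -/
theorem eventually_pow_mul_criticalTwoPoint_le {κ : ℝ} (hκ0 : 0 < κ)
    (hκ : ∀ n : ℕ, 1 ≤ n → κ * criticalTwoPoint 3 (Pi.single 0 ((n : ℕ) : ℤ)) ≤
      criticalTwoPoint 3 (Pi.single 0 ((2 * n : ℕ) : ℤ)))
    {x : Fin 2 → EuclideanSpace ℝ (Fin 3)} (hx : x ∈ NonCoincident 3 2)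
    (y : Fin 2 → EuclideanSpace ℝ (Fin 3)) :
    ∃ k : ℕ, ∀ᶠ δ in 𝓝[>] (0 : ℝ),
      κ ^ k * criticalTwoPoint 3 (latticeApprox δ (x 1) - latticeApprox δ (x 0)) ≤
        criticalTwoPoint 3 (latticeApprox δ (y 1) - latticeApprox δ (y 0)) := by
  have hinj : Function.Injective x := hx
  have hne : x 0 ≠ x 1 := fun h => absurd (hinj h) (by decide)
  obtain ⟨k0, hk0⟩ : ∃ k, x 0 k ≠ x 1 k := by
    by_contra h
    push Not at h
    exact hne (PiLp.ext h)
  set t : ℝ := |x 1 k0 - x 0 k0| with ht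
  have htpos : 0 < t := abs_pos.2 (sub_ne_zero.2 (Ne.symm hk0))
  set R : ℝ := ‖y 1 - y 0‖ with hR
  have hR0 : 0 ≤ R := norm_nonneg _
  obtain ⟨k, hk⟩ := pow_unbounded_of_one_lt ((36 * R + 72) / t) (by norm_num : (1 : ℝ) < 2)
  refine ⟨k, ?_⟩
  have hev1 : ∀ᶠ δ in 𝓝[>] (0 : ℝ), δ < t / 12 :=
    (eventually_lt_nhds (by positivity : (0 : ℝ) < t / 12)).filter_mono nhdsWithin_le_nhds
  have hev2 : ∀ᶠ δ in 𝓝[>] (0 : ℝ), δ < 1 :=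
    (eventually_lt_nhds (by norm_num : (0 : ℝ) < 1)).filter_mono nhdsWithin_le_nhds
  have hev3 : ∀ᶠ δ in 𝓝[>] (0 : ℝ), 0 < δ := eventually_mem_nhdsWithin
  filter_upwards [hev1, hev2, hev3] with δ h1 h2 hδ
  set u := latticeApprox δ (x 1) - latticeApprox δ (x 0) with hu
  set v := latticeApprox δ (y 1) - latticeApprox δ (y 0) with hv
  -- the integer scale `m = ⌊t/(6δ)⌋`
  set z : ℝ := t / (6 * δ) with hz
  have hz2 : 2 ≤ z := by
    rw [hz, le_div_iff₀ (by positivity)]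
    linarith
  set m : ℕ := ⌊z⌋₊ with hm
  have hmz : (m : ℝ) ≤ z := Nat.floor_le (by linarith)
  have hzm : z < m + 1 := Nat.lt_floor_add_one z
  have hm1 : 1 ≤ m := Nat.one_le_iff_ne_zero.2 (Nat.pos_iff_ne_zero.1 (Nat.floor_pos.2 (by linarith)))
  -- `3m ≤ ‖u‖_∞`
  have hu_low : t / (2 * δ) ≤ (Site.supNorm u : ℝ) :=
    div_le_supNorm_latticeApprox_sub hδ (x 1) (x 0) k0 (by linarith)
  have hmu : 3 * m ≤ Site.supNorm u := by
    have h3z : 3 * z = t / (2 * δ) := by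
      rw [hz]
      field_simp
      ring
    have : ((3 * m : ℕ) : ℝ) ≤ (Site.supNorm u : ℝ) := by
      push_cast
      linarith
    exact_mod_cast this
  -- `3‖v‖_∞ ≤ 2ᵏ m`
  have hv_up : (Site.supNorm v : ℝ) ≤ R / δ + 2 := supNorm_latticeApprox_sub_le hδ (y 1) (y 0)
  have hkm : 3 * Site.supNorm v ≤ 2 ^ k * m := by
    have h2k : (36 * R + 72) / t < (2 : ℝ) ^ k := hk
    have h2kt : 36 * R + 72 < (2 : ℝ) ^ k * t := by
      rwa [div_lt_iff₀ htpos] at h2k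
    have hmz' : z / 2 ≤ (m : ℝ) := by linarith
    -- `2ᵏ m ≥ 2ᵏ z/2 = 2ᵏ t/(12δ) > (3R + 6)/δ ≥ 3R/δ + 6 ≥ 3‖v‖_∞`
    have hA : (3 * R + 6) / δ ≤ (2 : ℝ) ^ k * (z / 2) := by
      rw [hz, div_le_iff₀ hδ]
      have : (2 : ℝ) ^ k * (t / (6 * δ) / 2) * δ = (2 : ℝ) ^ k * t / 12 := by
        field_simp
        ring
      rw [this]
      linarith
    have hB : 3 * (R / δ + 2) ≤ (3 * R + 6) / δ := by
      rw [le_div_iff₀ hδ]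
      have : 3 * (R / δ + 2) * δ = 3 * R + 6 * δ := by
        field_simp
        ring
      rw [this]
      linarith
    have hC : (2 : ℝ) ^ k * (z / 2) ≤ (2 : ℝ) ^ k * m :=
      mul_le_mul_of_nonneg_left hmz' (by positivity)
    have : ((3 * Site.supNorm v : ℕ) : ℝ) ≤ ((2 ^ k * m : ℕ) : ℝ) := by
      push_cast
      linarith
    exact_mod_cast this
  exact le_criticalTwoPoint_of_doubling hκ0 hκ u v hm1 hmu hkm

/-- **Item stmt-CriticalPhenomena-6327 `NondegeneracyOfDoubling`.** All-scale axis doubling of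
the critical two-point function of the nearest-neighbour Ising model on `ℤ³` implies the
non-degeneracy transfer: a pointwise scaling limit `S` of the critical correlators with `S₂ > 0`
at one non-coincident pair has `S₂ > 0` at every non-coincident pair. [folklore] -/
theorem nondegeneracyOfDoubling_proof :
    Summit.CriticalPhenomena.Ising3DConformalLimit.Theses.ThresholdDilation.NondegeneracyOfDoubling := by
  unfold Summit.CriticalPhenomena.Ising3DConformalLimit.Theses.ThresholdDilation.NondegeneracyOfDoubling
  rintro ⟨κ, hκ0, hκ⟩ ρ S _ hlim ⟨x, hx, hSx⟩ y hy
  obtain ⟨k, hk⟩ := eventually_pow_mul_criticalTwoPoint_le hκ0 hκ hx y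
  have hcx : Tendsto (fun δ => rescaledCorrelator (criticalCorr 3) ρ 2 δ x) (𝓝[>] 0) (𝓝 (S 2 x)) :=
    (hlim 2).tendsto_at hx
  have hcy : Tendsto (fun δ => rescaledCorrelator (criticalCorr 3) ρ 2 δ y) (𝓝[>] 0) (𝓝 (S 2 y)) :=
    (hlim 2).tendsto_at hy
  have hkey : ∀ᶠ δ in 𝓝[>] (0 : ℝ),
      κ ^ k * rescaledCorrelator (criticalCorr 3) ρ 2 δ x ≤
        rescaledCorrelator (criticalCorr 3) ρ 2 δ y := by
    filter_upwards [hk] with δ hδ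
    rw [rescaledCorrelator_apply, rescaledCorrelator_apply, latticeApprox_comp_two,
      latticeApprox_comp_two, criticalCorr_two_pair, criticalCorr_two_pair]
    calc κ ^ k * (ρ δ ^ 2 * criticalTwoPoint 3 (latticeApprox δ (x 1) - latticeApprox δ (x 0)))
        = ρ δ ^ 2 * (κ ^ k * criticalTwoPoint 3 (latticeApprox δ (x 1) - latticeApprox δ (x 0))) := by
          ring
      _ ≤ ρ δ ^ 2 * criticalTwoPoint 3 (latticeApprox δ (y 1) - latticeApprox δ (y 0)) :=
          mul_le_mul_of_nonneg_left hδ (sq_nonneg _)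
  have hle : κ ^ k * S 2 x ≤ S 2 y := le_of_tendsto_of_tendsto (hcx.const_mul (κ ^ k)) hcy hkey
  exact lt_of_lt_of_le (mul_pos (pow_pos hκ0 k) hSx) hle

end Summit.CriticalPhenomena.Ising3DConformalLimit.ThresholdDilationNondegeneracyOfDoubling
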